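import Summits.HodgeConjecture.HodgeConjecture.Theorems.F0LD1ThetaTransportKit
import Summits.HodgeConjecture.HodgeConjecture.Theorems.F0P6LD1ThetaCharacterPin
import Summits.HodgeConjecture.HodgeConjecture.Theorems.F0LD2FrameTransportPin
import HarnessLib

-- As in the lineage (★ `ThetaLiftFromLineCentralCharacter`): statements over the theta-kernel datum elaborate to very large types; elaborate sequentially.
set_option Elab.async false

/-!
# Crux `HLiu418`, line LD1, organ (I) `stub_thetaCharRigid` — part (B): THE CENTRAL-CHARACTER UPGRADE OF THE SEAM
# «`P` meets the theta lift from `⟨a⟩` ⟹ for the character `ξ_P` of `[U(⟨a⟩)]` read off the central character of `P`, the theta class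
# `[Θ̃_Φ(ξ_P) ∘ ιA]` ITSELF lies in `P` and is non-zero» — no multiplicity-one input

Cell hodgecm-mathlib (D-0151), FLOOR 0; crux item `HLiu418` = stmt-HodgeConjecture-24832; half-A line LD1 (`stub_S1_facts` = #73 E1θhol of socket 27458
`Cruxes/HLiu418/Lines/F0_AlbCm.lean`), skeleton `F0/P6/LD/LD1-plan/g0/StubS1facts.inhouse.skeleton.v1.lean` (LD1-plan (g0)), organ (I)
`ThetaCharRigid₂ = «Meets ⇒ ∃ ξ, CharThetaSpaceLe₂ ∧ CharSeam₂»`; this file pays the `CharSeam₂` half (rank-generic `N`, abstract transport `ιA`).  Seat LD1-p01 (g0).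
THEOREMS ONLY (no `def`, no instance, no notation, no named fact, no `sorry`); `--supports stmt-HodgeConjecture-24832`.  HC_CM is proved only modulo the 7
printed citations (2 remaining: hLiu418 = stmt-HodgeConjecture-24832, h413 = stmt-HodgeConjecture-24833) until rung 0 closes; nothing printed is discharged here.

THE ARGUMENT ([Liu2021, proof of Prop. 4.13 Case 1, l. 2136–2137: «the central character `χ` of `π` … `π^∞ ≃ ω(μ, ε_e, χ)`»], made honest on `L²`).
Let `v = [Θ̃_Φ(f) ∘ ιA] ∈ P`, `v ≠ 0` (the seam ★ `MeetsThetaLiftFromLine`).  `P` has a unitary central character `ψ` (★ `exists_centralCharacter_adelicCenter`);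
let `E_ψ ⊆ L²([U(H)])` be the closed `ψ`-eigenspace of the centre `u·1_H`, so `P ≤ E_ψ` and `pr_{E_ψ} v = v`.  For a character `χ` of `[U(⟨a⟩)]` the class
`w_χ = [Θ̃_Φ(χ) ∘ ιA]` is a `(χ ∘ centre)`-eigenvector (★ `F0P6LD1ThetaCharacterPin.rightRegular_adelicCenter_toLp_transport_charCM`, [GelbartRogawski1991, §3.1: the two
centres agree in the big unitary group]); eigenvectors of the unitary `R` with DIFFERENT unitary eigencharacters are orthogonal, so `pr_{E_ψ} w_χ = w_χ` if `χ ∘ centre = ψ`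
and `= 0` otherwise, and at most ONE `χ = ξ` matches (`u ↦ u·1_W` is onto `U(⟨a⟩)(𝔸)`, ★ `F0P6LD1ThetaCharacterPin.charQuot_ext_of_adelicCenter`).  By character detection (★ kit
`exists_charCM_of_apply_toLp_lineThetaLift_ne_zero`: a continuous linear map killing every `w_χ` kills `v`) applied to `pr_{E_ψ}` a matching `ξ` EXISTS, and
applied to the functional `x ↦ ⟪u, pr_{E_ψ} x⟫`, `u = ⟪w_ξ, w_ξ⟫ v − ⟪w_ξ, v⟫ w_ξ ⊥ w_ξ` (which kills every `w_χ`), `⟪u, v⟫ = 0`, whence `⟪u, u⟫ = 0` and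
`⟪w_ξ, w_ξ⟫ v = ⟪w_ξ, v⟫ w_ξ`; hence `w_ξ = c⁻¹ v ∈ P`, `w_ξ ≠ 0`.  (★ T5a's node-B remark
«one cannot land `Θ̃_Φ(χ)` itself in `P` without a multiplicity-one statement» concerns an ARBITRARY detecting `χ`; for the central one it lands.)

* `charSeam_of_meets` — for the letters' scaled frame `formCongr c g (t • H) = diag dV` and a transport `ιA` PINNED by `↑(ιA k) = g_𝔸⁻¹ k g_𝔸` (continuous and
  rational-to-rational by ★ `F0LD2FrameTransportPin`, fixing the centre by ★ `frameTransport_adelicCenter`), `[U(diag dV)]` and `[U(H)]` compact, a discrete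
  `P` and a line `⟨a⟩`: `MeetsThetaLiftFromLine L N H e₁ dV hdV hdV0 P μ hμ a ιA → ∃ ξ, ‹body of the skeleton's CharSeam₂ at (P, μ, a, ιA, ξ)›` (same
  majorant witness, measure and `Φ` as the seam).

References: [Liu2021] Y. Liu, Camb. J. Math. 9 (2021), proof of Prop. 4.13 Case 1 (l. 2131–2137, p. 48); proof of Prop. D.4 (1) (p. 131).  [GelbartRogawski1991]
S. Gelbart, J. Rogawski, Invent. Math. 105 (1991), §3.1 Prop. 3.1.1 p. 455, Remark p. 457; §3.2 p. 457.  [DeitmarEchterhoff2014] A. Deitmar, S. Echterhoff (2014),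
Prop. 3.5.2, Thm. 7.3.2.  [Dixmier1977] J. Dixmier, *C*-algebras* (1977), §5.4, §13.1.  [BorelJacquet1979] A. Borel, H. Jacquet, PSPM 33.1 (1979), §4.6.
-/

set_option autoImplicit false
-- the mandated namespace has the single-problem summit's repeated segment (`HodgeConjecture.HodgeConjecture`)
set_option linter.dupNamespace false

noncomputable section

open NumberField MeasureTheory IsDedekindDomain
open scoped Matrix Kronecker ComplexOrder ENNReal InnerProductSpace
open Literature.NumberTheory.Automorphic Literature.NumberTheory.Automorphic.UnitaryGroup
open Literature.NumberTheory.Automorphic.UnitaryGroup.CotangentForms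
open Literature.NumberTheory.Automorphic.IdeleClassGroup
open Literature.NumberTheory.Automorphic.Liu2021
open Literature.NumberTheory.Automorphic.Liu2021.Def411WeilCarriers
open Literature.NumberTheory.Automorphic.Liu2021.Def411WeilCarriersDoubling
open Literature.NumberTheory.GelbartRogawski1991 Literature.NumberTheory.GelbartRogawski1991.UnitaryDualPair
open Literature.NumberTheory.Weil1964
open Literature.RepresentationTheory.Liu2021
open Literature.RepresentationTheory.CompactGroups
open Literature.RepresentationTheory.HeisenbergGroup
open Summit.HodgeConjecture.HodgeConjecture.Cruxes.HLiu418.F0P6LD1ThetaCharacterPin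
open Summit.HodgeConjecture.HodgeConjecture.Cruxes.HLiu418.F0LD2FrameTransportPin

namespace Summit.HodgeConjecture.HodgeConjecture.Cruxes.HLiu418.F0LD1CharSeamOfMeets

section Generic

variable {𝕜 : Type*} {V : Type*} [NormedAddCommGroup V] [InnerProductSpace ℂ V]

/-- **Eigenvectors of a unitary family with DIFFERENT unitary eigenvalues are orthogonal**: if `U` preserves inner products, `U x = s • x`, `U y = t • y`
with `‖s‖ = 1` and `s ≠ t`, then `⟪x, y⟫ = 0`. [cite: Dixmier1977, §13.1] -/
theorem inner_eq_zero_of_eigen_ne {U : V →L[ℂ] V} (hU : ∀ x y : V, ⟪U x, U y⟫_ℂ = ⟪x, y⟫_ℂ) {x y : V} {s t : ℂ}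
    (hx : U x = s • x) (hy : U y = t • y) (hs : ‖s‖ = 1) (hst : s ≠ t) : ⟪x, y⟫_ℂ = 0 := by
  have h := hU x y
  rw [hx, hy, inner_smul_left, inner_smul_right, ← mul_assoc] at h
  -- `(conj s * t) * ⟪x,y⟫ = ⟪x,y⟫`, and `conj s * t ≠ 1` since `conj s * s = 1` and `s ≠ t`
  have hss : (starRingEnd ℂ) s * s = 1 := by
    rw [mul_comm, Complex.mul_conj, Complex.normSq_eq_norm_sq, hs]; norm_num
  have hne : (starRingEnd ℂ) s * t ≠ 1 := by
    intro h1
    apply hst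
    have hs0 : (starRingEnd ℂ) s ≠ 0 := by
      intro h0; rw [h0, zero_mul] at hss; exact zero_ne_one hss
    exact mul_left_cancel₀ hs0 (hss.trans h1.symm)
  have key : ((starRingEnd ℂ) s * t - 1) * ⟪x, y⟫_ℂ = 0 := by rw [sub_mul, one_mul, h, sub_self]
  rcases mul_eq_zero.1 key with h0 | h0
  · exact absurd (sub_eq_zero.1 h0) hne
  · exact h0

end Generic

section Seam

variable (L : Type) [Field L] [NumberField L] [IsCMField L] (N : ℕ) (H : Matrix (Fin N) (Fin N) L)
  {n' : ℕ} (e₁ : Fin N × Fin 1 ≃ Fin n') (dV : Fin N → L) (hdV : ∀ i, IsCMField.complexConj L (dV i) = dV i)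
  (hdV0 : ∀ i, dV i ≠ 0)
  (t : L) (ht : t ≠ 0) (g : GL (Fin N) L)
  (hg : formCongr ((IsCMField.complexConj L : L ≃ₐ[(↥(maximalRealSubfield L))] L) : L →+* L) g (t • H) = Matrix.diagonal dV)
  (ιA : (adelicGroupData (↥(maximalRealSubfield L)) L (IsCMField.complexConj L) N H).Adelic →* ↥(UnitaryGroup.adelic (↥(maximalRealSubfield L)) L (IsCMField.complexConj L) N (Matrix.diagonal dV)))
  (hιA : ∀ k, ((ιA k : ↥(UnitaryGroup.adelic (↥(maximalRealSubfield L)) L (IsCMField.complexConj L) N (Matrix.diagonal dV))) : GL (Fin N) (AdeleRing (𝓞 L) L)) =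
    (toAdeleGL L g)⁻¹ * adelicVal (↥(maximalRealSubfield L)) L (IsCMField.complexConj L) N H k * toAdeleGL L g)
  [CompactSpace (↥(UnitaryGroup.adelic (↥(maximalRealSubfield L)) L (IsCMField.complexConj L) N (Matrix.diagonal dV)) ⧸ (UnitaryGroup.toAdelic (↥(maximalRealSubfield L)) L (IsCMField.complexConj L) N (Matrix.diagonal dV)).range)]
  {μA : Measure (adelicGroupData (↥(maximalRealSubfield L)) L (IsCMField.complexConj L) N H).automorphicQuotient} [(adelicGroupData (↥(maximalRealSubfield L)) L (IsCMField.complexConj L) N H).IsAutomorphicMeasure μA] [CompactSpace (adelicGroupData (↥(maximalRealSubfield L)) L (IsCMField.complexConj L) N H).automorphicQuotient]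

set_option maxHeartbeats 1600000 in
-- (as in the ★ lineage `ThetaLiftFromLineCentralCharacter`: the theta-kernel datum types are very large; the linters' `whnf` passes
-- over the local context of this proof exceed the default budget)
include ht hg hιA in
/-- **PART (B) OF ORGAN (I): the central-character upgrade of the seam.**  If the discrete `P` MEETS the theta lift from the line `⟨a⟩` at the `μ`-splitting
along the transport `ιA` (★ `MeetsThetaLiftFromLine`: a non-zero class `[Θ̃_Φ(f) ∘ ιA] ∈ P` for some continuous weight `f`), then for some unitary CHARACTER
`ξ` of the compact abelian group `[U(⟨a⟩)]` — the one whose pull-back along the centre is the central character of `P` — the theta class `[Θ̃_Φ(ξ) ∘ ιA]`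
(same majorant witness, same measure on `[U(⟨a⟩)]`, same Schwartz–Bruhat `Φ`) LIES IN `P` and is non-zero.  The conclusion is the body of the LD1 skeleton's
`CharSeam₂ L H e₁ dV hdV hdV0 P μ hμ a ιA ξ` (at `N = 2`), stated rank-generically.  See the module docstring for the proof.
[cite: Liu2021, proof of Prop. 4.13 Case 1 (l. 2131–2137, p. 48)] [cite: GelbartRogawski1991, §3.1 Prop. 3.1.1 p. 455 and Remark p. 457; §3.2 p. 457]
[cite: DeitmarEchterhoff2014, Prop. 3.5.2; Thm. 7.3.2] [cite: Dixmier1977, §5.4] -/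
theorem charSeam_of_meets (P : DiscreteAutomorphicRep (adelicGroupData (↥(maximalRealSubfield L)) L (IsCMField.complexConj L) N H) μA)
    (μ : Literature.NumberTheory.Automorphic.IdeleClassGroup L →ₜ* Circle) (hμ : IsConjugateSymplectic L μ) (a : (↥(maximalRealSubfield L))ˣ)
    (hmeet : MeetsThetaLiftFromLine L N H e₁ dV hdV hdV0 P μ hμ a ιA) :
    letI : MeasurableSpace (↥(UnitaryGroup.adelic (↥(maximalRealSubfield L)) L (IsCMField.complexConj L) 1 (JW (↥(maximalRealSubfield L)) L a)) ⧸ (UnitaryGroup.toAdelic (↥(maximalRealSubfield L)) L (IsCMField.complexConj L) 1 (JW (↥(maximalRealSubfield L)) L a)).range) := borel _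
    haveI := normal_range_toAdelic_JW L a
    ∃ (ξ : PontryaginDual (↥(UnitaryGroup.adelic (↥(maximalRealSubfield L)) L (IsCMField.complexConj L) 1 (JW (↥(maximalRealSubfield L)) L a)) ⧸ (UnitaryGroup.toAdelic (↥(maximalRealSubfield L)) L (IsCMField.complexConj L) 1 (JW (↥(maximalRealSubfield L)) L a)).range))
      (hρ : HasThetaMajorants fun
      (p : ↥(UnitaryGroup.adelic (↥(maximalRealSubfield L)) L (IsCMField.complexConj L) N (Matrix.diagonal dV)) × ↥(UnitaryGroup.adelic (↥(maximalRealSubfield L)) L (IsCMField.complexConj L) 1 (JW (↥(maximalRealSubfield L)) L a))) (Φ : piSchwartzBruhat (↥(maximalRealSubfield L)) (Fin n')) =>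
        pairRep (↥(maximalRealSubfield L)) L (IsCMField.complexConj L) N 1 e₁ (Matrix.diagonal dV) (JW (↥(maximalRealSubfield L)) L a)
          (chiSplittingLine L e₁ dV hdV hdV0 (toHeckeCharacter L μ) (isUnitary_toHeckeCharacter L μ)
            ((isOscillatorChar_toHeckeCharacter_iff μ).mpr hμ) (TW (↥(maximalRealSubfield L)) a)
            (isUnit_det_TW (↥(maximalRealSubfield L)) a) (JW (↥(maximalRealSubfield L)) L a) (JW_eq (↥(maximalRealSubfield L)) L a))
          p Φ)
      (μW : Measure (↥(UnitaryGroup.adelic (↥(maximalRealSubfield L)) L (IsCMField.complexConj L) 1 (JW (↥(maximalRealSubfield L)) L a)) ⧸ (UnitaryGroup.toAdelic (↥(maximalRealSubfield L)) L (IsCMField.complexConj L) 1 (JW (↥(maximalRealSubfield L)) L a)).range)) (_ : IsFiniteMeasure μW)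
      (_ : SMulInvariantMeasure ↥(UnitaryGroup.adelic (↥(maximalRealSubfield L)) L (IsCMField.complexConj L) 1 (JW (↥(maximalRealSubfield L)) L a)) (↥(UnitaryGroup.adelic (↥(maximalRealSubfield L)) L (IsCMField.complexConj L) 1 (JW (↥(maximalRealSubfield L)) L a)) ⧸ (UnitaryGroup.toAdelic (↥(maximalRealSubfield L)) L (IsCMField.complexConj L) 1 (JW (↥(maximalRealSubfield L)) L a)).range) μW)
      (Ψ : piSchwartzBruhat (↥(maximalRealSubfield L)) (Fin n'))
      (hθ : MemLp (toQuotFun (adelicGroupData (↥(maximalRealSubfield L)) L (IsCMField.complexConj L) N H) fun x =>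
        (lineThetaKernelDatum L N e₁ dV hdV hdV0 μ hμ a hρ).thetaLiftFun μW Ψ (charCM ξ) (ιA x)) 2 μA),
      MemLp.toLp _ hθ ∈ P.space.toSubmodule ∧ MemLp.toLp _ hθ ≠ 0 := by
  letI : MeasurableSpace (↥(UnitaryGroup.adelic (↥(maximalRealSubfield L)) L (IsCMField.complexConj L) 1 (JW (↥(maximalRealSubfield L)) L a)) ⧸ (UnitaryGroup.toAdelic (↥(maximalRealSubfield L)) L (IsCMField.complexConj L) 1 (JW (↥(maximalRealSubfield L)) L a)).range) := borel _
  haveI : BorelSpace (↥(UnitaryGroup.adelic (↥(maximalRealSubfield L)) L (IsCMField.complexConj L) 1 (JW (↥(maximalRealSubfield L)) L a)) ⧸ (UnitaryGroup.toAdelic (↥(maximalRealSubfield L)) L (IsCMField.complexConj L) 1 (JW (↥(maximalRealSubfield L)) L a)).range) := ⟨rfl⟩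
  haveI hN := normal_range_toAdelic_JW L a
  obtain ⟨hρ, μW, hfin, hinv, f, Φ, hθ, hmem, hne⟩ := hmeet
  -- (0) the transport is continuous and carries rational points to rational points (★ `F0LD2FrameTransportPin`)
  have hT : Continuous ιA ∧ ∀ ⦃γ : (adelicGroupData (↥(maximalRealSubfield L)) L (IsCMField.complexConj L) N H).Adelic⦄,
      γ ∈ (UnitaryGroup.toAdelic (↥(maximalRealSubfield L)) L (IsCMField.complexConj L) N H).range →
        ιA γ ∈ (UnitaryGroup.toAdelic (↥(maximalRealSubfield L)) L (IsCMField.complexConj L) N (Matrix.diagonal dV)).range :=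
    ⟨continuous_of_pin L N H dV g ιA hιA, fun γ hγ => mem_range_toAdelic_of_pin L N H dV t ht g hg ιA hιA hγ⟩
  have hιArat : ∀ γ : (adelicGroupData (↥(maximalRealSubfield L)) L (IsCMField.complexConj L) N H).Rational,
      ιA ((adelicGroupData (↥(maximalRealSubfield L)) L (IsCMField.complexConj L) N H).toAdelic γ) ∈ (UnitaryGroup.toAdelic (↥(maximalRealSubfield L)) L (IsCMField.complexConj L) N (Matrix.diagonal dV)).range :=
    fun γ => hT.2 ⟨γ, rfl⟩
  have hU : ((adelicGroupData (↥(maximalRealSubfield L)) L (IsCMField.complexConj L) N H).rightRegular μA).IsUnitary := (adelicGroupData (↥(maximalRealSubfield L)) L (IsCMField.complexConj L) N H).isUnitary_rightRegular μA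
  -- the character classes `w χ` (square-integrable for every weight, kit `memLp_toQuotFun_lineThetaLift`) and the seam vector `v`
  have hwdef : ∀ χ : PontryaginDual (↥(UnitaryGroup.adelic (↥(maximalRealSubfield L)) L (IsCMField.complexConj L) 1 (JW (↥(maximalRealSubfield L)) L a)) ⧸ (UnitaryGroup.toAdelic (↥(maximalRealSubfield L)) L (IsCMField.complexConj L) 1 (JW (↥(maximalRealSubfield L)) L a)).range),
      MemLp (toQuotFun (adelicGroupData (↥(maximalRealSubfield L)) L (IsCMField.complexConj L) N H) fun x => (lineThetaKernelDatum L N e₁ dV hdV hdV0 μ hμ a hρ).thetaLiftFun μW Φ (charCM χ) (ιA x)) 2 μA :=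
    fun χ => F0LD1ThetaTransportKit.memLp_toQuotFun_lineThetaLift L N H e₁ dV hdV hdV0 ιA hT μ hμ a hρ μW Φ (charCM χ) μA 2
  obtain ⟨v, hv⟩ : ∃ v : (adelicGroupData (↥(maximalRealSubfield L)) L (IsCMField.complexConj L) N H).L2 μA, v = MemLp.toLp _ hθ := ⟨_, rfl⟩
  have hvmem : v ∈ P.space.toSubmodule := hv ▸ hmem
  have hv0 : v ≠ 0 := hv ▸ hne
  -- (1) the central character `ψ` of `P` and its closed eigenspace `E`
  obtain ⟨ψ, hψ1, -, -, hψ⟩ := P.exists_centralCharacter_adelicCenter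
  set E : Submodule ℂ ((adelicGroupData (↥(maximalRealSubfield L)) L (IsCMField.complexConj L) N H).L2 μA) :=
    ⨅ u, LinearMap.eqLocus ((adelicGroupData (↥(maximalRealSubfield L)) L (IsCMField.complexConj L) N H).rightRegular μA (adelicCenter (↥(maximalRealSubfield L)) L (IsCMField.complexConj L) N H u)).toLinearMap (((ψ u : ℂˣ) : ℂ) • LinearMap.id) with hE
  have hmemE : ∀ x : (adelicGroupData (↥(maximalRealSubfield L)) L (IsCMField.complexConj L) N H).L2 μA, x ∈ E ↔ ∀ u, (adelicGroupData (↥(maximalRealSubfield L)) L (IsCMField.complexConj L) N H).rightRegular μA (adelicCenter (↥(maximalRealSubfield L)) L (IsCMField.complexConj L) N H u) x = ((ψ u : ℂˣ) : ℂ) • x := by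
    intro x
    simp only [hE, Submodule.mem_iInf, LinearMap.mem_eqLocus, ContinuousLinearMap.coe_coe, LinearMap.smul_apply, LinearMap.id_apply]
  have hEset : (E : Set ((adelicGroupData (↥(maximalRealSubfield L)) L (IsCMField.complexConj L) N H).L2 μA)) = ⋂ u, {x | (adelicGroupData (↥(maximalRealSubfield L)) L (IsCMField.complexConj L) N H).rightRegular μA (adelicCenter (↥(maximalRealSubfield L)) L (IsCMField.complexConj L) N H u) x = ((ψ u : ℂˣ) : ℂ) • x} :=
    Set.ext fun x => by rw [SetLike.mem_coe, hmemE, Set.mem_iInter]; rfl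
  have hEclosed : IsClosed (E : Set ((adelicGroupData (↥(maximalRealSubfield L)) L (IsCMField.complexConj L) N H).L2 μA)) := by
    rw [hEset]
    exact isClosed_iInter fun u => isClosed_eq ((adelicGroupData (↥(maximalRealSubfield L)) L (IsCMField.complexConj L) N H).rightRegular μA (adelicCenter (↥(maximalRealSubfield L)) L (IsCMField.complexConj L) N H u)).continuous (continuous_const_smul _)
  haveI : CompleteSpace E := hEclosed.completeSpace_coe
  -- `P ≤ E`, so `pr_E v = v`
  have hPE : ∀ x ∈ P.space.toSubmodule, x ∈ E := by
    intro x hx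
    rw [hmemE]
    intro u
    have h := congrArg Subtype.val (hψ u ⟨x, hx⟩)
    rw [ContRepresentation.ClosedSubrep.coe_toContRep_apply] at h
    exact h
  have hprv : E.starProjection v = v := Submodule.starProjection_eq_self_iff.mpr (hPE v hvmem)
  -- (2) the character classes are eigenvectors of the centre: `R(u·1_H) w_χ = χ([u·1_W]) • w_χ` (★ `F0P6LD1ThetaCharacterPin`)
  have heig : ∀ (χ : PontryaginDual (↥(UnitaryGroup.adelic (↥(maximalRealSubfield L)) L (IsCMField.complexConj L) 1 (JW (↥(maximalRealSubfield L)) L a)) ⧸ (UnitaryGroup.toAdelic (↥(maximalRealSubfield L)) L (IsCMField.complexConj L) 1 (JW (↥(maximalRealSubfield L)) L a)).range)) (u : ↥(adelicOne (↥(maximalRealSubfield L)) L (IsCMField.complexConj L))),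
      (adelicGroupData (↥(maximalRealSubfield L)) L (IsCMField.complexConj L) N H).rightRegular μA (adelicCenter (↥(maximalRealSubfield L)) L (IsCMField.complexConj L) N H u) (MemLp.toLp _ (hwdef χ)) =
        ((χ (QuotientGroup.mk (adelicCenter (↥(maximalRealSubfield L)) L (IsCMField.complexConj L) 1 (JW (↥(maximalRealSubfield L)) L a) u)) : Circle) : ℂ) • MemLp.toLp _ (hwdef χ) :=
    fun χ u => rightRegular_adelicCenter_toLp_transport_charCM L N H e₁ dV hdV hdV0 g μ hμ a hρ ιA hιA hιArat μW Φ μA u χ (hwdef χ)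
  -- matching characters: `pr_E w_χ = w_χ`; non-matching: `pr_E w_χ = 0` (eigenvectors with different unitary eigenvalues are orthogonal)
  have hmatch : ∀ χ : PontryaginDual (↥(UnitaryGroup.adelic (↥(maximalRealSubfield L)) L (IsCMField.complexConj L) 1 (JW (↥(maximalRealSubfield L)) L a)) ⧸ (UnitaryGroup.toAdelic (↥(maximalRealSubfield L)) L (IsCMField.complexConj L) 1 (JW (↥(maximalRealSubfield L)) L a)).range),
      (∀ u, ((ψ u : ℂˣ) : ℂ) = ((χ (QuotientGroup.mk (adelicCenter (↥(maximalRealSubfield L)) L (IsCMField.complexConj L) 1 (JW (↥(maximalRealSubfield L)) L a) u)) : Circle) : ℂ)) →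
        E.starProjection (MemLp.toLp _ (hwdef χ)) = MemLp.toLp _ (hwdef χ) := by
    intro χ hχ
    refine Submodule.starProjection_eq_self_iff.mpr ((hmemE _).2 fun u => ?_)
    rw [heig χ u, hχ u]
  have hnomatch : ∀ χ : PontryaginDual (↥(UnitaryGroup.adelic (↥(maximalRealSubfield L)) L (IsCMField.complexConj L) 1 (JW (↥(maximalRealSubfield L)) L a)) ⧸ (UnitaryGroup.toAdelic (↥(maximalRealSubfield L)) L (IsCMField.complexConj L) 1 (JW (↥(maximalRealSubfield L)) L a)).range),
      (∃ u, ((ψ u : ℂˣ) : ℂ) ≠ ((χ (QuotientGroup.mk (adelicCenter (↥(maximalRealSubfield L)) L (IsCMField.complexConj L) 1 (JW (↥(maximalRealSubfield L)) L a) u)) : Circle) : ℂ)) →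
        E.starProjection (MemLp.toLp _ (hwdef χ)) = 0 := by
    rintro χ ⟨u, hu⟩
    refine (Submodule.starProjection_apply_eq_zero_iff E).2 ((Submodule.mem_orthogonal _ _).2 fun x hx => ?_)
    exact inner_eq_zero_of_eigen_ne (fun x y => hU.inner_map_map _ x y) (((hmemE x).1 hx) u) (heig χ u) (hψ1 u) hu
  -- (3) a matching character `ξ` EXISTS (character detection through `pr_E`, which does not kill `v`) …
  have hprv0 : E.starProjection (MemLp.toLp _ hθ) ≠ 0 := by
    rw [← hv, hprv]
    exact hv0
  obtain ⟨ξ, hξ⟩ := F0LD1ThetaTransportKit.exists_charCM_of_apply_toLp_lineThetaLift_ne_zero L N H e₁ dV hdV hdV0 ιA hT μ hμ a hρ μW Φ f μA E.starProjection hprv0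
  have hξψ : ∀ u, ((ψ u : ℂˣ) : ℂ) = ((ξ (QuotientGroup.mk (adelicCenter (↥(maximalRealSubfield L)) L (IsCMField.complexConj L) 1 (JW (↥(maximalRealSubfield L)) L a) u)) : Circle) : ℂ) := by
    by_contra hcon
    push Not at hcon
    exact hξ (hnomatch ξ hcon)
  -- … and is UNIQUE: the centre is onto `U(⟨a⟩)(𝔸)` (★ `charQuot_ext_of_adelicCenter`)
  have huniq : ∀ χ : PontryaginDual (↥(UnitaryGroup.adelic (↥(maximalRealSubfield L)) L (IsCMField.complexConj L) 1 (JW (↥(maximalRealSubfield L)) L a)) ⧸ (UnitaryGroup.toAdelic (↥(maximalRealSubfield L)) L (IsCMField.complexConj L) 1 (JW (↥(maximalRealSubfield L)) L a)).range), χ ≠ ξ →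
      ∃ u, ((ψ u : ℂˣ) : ℂ) ≠ ((χ (QuotientGroup.mk (adelicCenter (↥(maximalRealSubfield L)) L (IsCMField.complexConj L) 1 (JW (↥(maximalRealSubfield L)) L a) u)) : Circle) : ℂ) := by
    intro χ hχ
    by_contra hcon
    push Not at hcon
    exact hχ (charQuot_ext_of_adelicCenter L a χ ξ fun u => Subtype.ext ((hcon u).symm.trans (hξψ u)))
  -- (4) `w = w_ξ`: the functional `x ↦ ⟪u, pr_E x⟫` with `u = ⟪w, w⟫ • v - ⟪w, v⟫ • w ⊥ w` kills EVERY character class, hence (character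
  -- detection) kills `v`; so `⟪u, v⟫ = 0`, `⟪u, u⟫ = 0`, `u = 0`: `⟪w, w⟫ • v = ⟪w, v⟫ • w`
  obtain ⟨w, hw⟩ : ∃ w : (adelicGroupData (↥(maximalRealSubfield L)) L (IsCMField.complexConj L) N H).L2 μA, w = MemLp.toLp _ (hwdef ξ) := ⟨_, rfl⟩
  have hprw : E.starProjection w = w := by rw [hw]; exact hmatch ξ hξψ
  have hw0 : w ≠ 0 := by
    intro h0
    apply hξ
    rw [← hw, h0, map_zero]
  -- the test vector `u = ⟪w, w⟫ • v - ⟪w, v⟫ • w ⊥ w` and the functional `x ↦ ⟪u, pr_E x⟫`, which kills every character class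
  obtain ⟨u, hu⟩ : ∃ u : (adelicGroupData (↥(maximalRealSubfield L)) L (IsCMField.complexConj L) N H).L2 μA, u = ⟪w, w⟫_ℂ • v - ⟪w, v⟫_ℂ • w := ⟨_, rfl⟩
  have hwu : ⟪w, u⟫_ℂ = 0 := by
    rw [hu, inner_sub_right, inner_smul_right, inner_smul_right, mul_comm, sub_self]
  have huw : ⟪u, w⟫_ℂ = 0 := inner_eq_zero_symm.1 hwu
  obtain ⟨T₀, hT₀⟩ : ∃ T₀ : (adelicGroupData (↥(maximalRealSubfield L)) L (IsCMField.complexConj L) N H).L2 μA →L[ℂ] ℂ, T₀ = (innerSL ℂ u).comp E.starProjection := ⟨_, rfl⟩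
  have hT₀x : ∀ x : (adelicGroupData (↥(maximalRealSubfield L)) L (IsCMField.complexConj L) N H).L2 μA, T₀ x = ⟪u, E.starProjection x⟫_ℂ := by
    intro x
    rw [hT₀, ContinuousLinearMap.comp_apply, innerSL_apply_apply]
  have hT₀χ : ∀ χ : PontryaginDual (↥(UnitaryGroup.adelic (↥(maximalRealSubfield L)) L (IsCMField.complexConj L) 1 (JW (↥(maximalRealSubfield L)) L a)) ⧸ (UnitaryGroup.toAdelic (↥(maximalRealSubfield L)) L (IsCMField.complexConj L) 1 (JW (↥(maximalRealSubfield L)) L a)).range), T₀ (MemLp.toLp _ (hwdef χ)) = 0 := by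
    intro χ
    by_cases hχ : χ = ξ
    · subst hχ
      rw [← hw, hT₀x, hprw, huw]
    · rw [hT₀x, hnomatch χ (huniq χ hχ), inner_zero_right]
  have hT₀v : T₀ v = 0 := by
    by_contra h0
    rw [hv] at h0
    obtain ⟨χ, hχ⟩ := F0LD1ThetaTransportKit.exists_charCM_of_apply_toLp_lineThetaLift_ne_zero L N H e₁ dV hdV hdV0 ιA hT μ hμ a hρ μW Φ f μA T₀ h0
    exact hχ (hT₀χ χ)
  have huv : ⟪u, v⟫_ℂ = 0 := by
    have h := hT₀v
    rw [hT₀x, hprv] at h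
    exact h
  -- hence `⟪u, u⟫ = ‖w‖² ⟪u, v⟫ - ⟪w, v⟫ ⟪u, w⟫ = 0`, `u = 0`, i.e. `⟪w, w⟫ • v = ⟪w, v⟫ • w`
  have huu : ⟪u, u⟫_ℂ = 0 := by
    calc ⟪u, u⟫_ℂ = ⟪u, ⟪w, w⟫_ℂ • v - ⟪w, v⟫_ℂ • w⟫_ℂ := by rw [← hu]
      _ = 0 := by rw [inner_sub_right, inner_smul_right, inner_smul_right, huv, huw, mul_zero, mul_zero, sub_zero]
  have hvw : ⟪w, w⟫_ℂ • v = ⟪w, v⟫_ℂ • w := by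
    rw [← sub_eq_zero, ← hu]
    exact inner_self_eq_zero.1 huu
  have hn0 : ⟪w, w⟫_ℂ ≠ 0 := inner_self_ne_zero.2 hw0
  -- so `v = c • w` with `c = ⟪w, v⟫ / ⟪w, w⟫ ≠ 0`, i.e. `w = c⁻¹ • v`
  have hv_eq : ((⟪w, w⟫_ℂ)⁻¹ * ⟪w, v⟫_ℂ) • w = v := by
    rw [mul_smul, ← hvw, smul_smul, inv_mul_cancel₀ hn0, one_smul]
  have hc0 : (⟪w, w⟫_ℂ)⁻¹ * ⟪w, v⟫_ℂ ≠ 0 := by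
    intro h0
    rw [h0, zero_smul] at hv_eq
    exact hv0 hv_eq.symm
  have hwv : w = ((⟪w, w⟫_ℂ)⁻¹ * ⟪w, v⟫_ℂ)⁻¹ • v := (eq_inv_smul_iff₀ hc0).2 hv_eq
  -- (5) conclusion: `w_ξ ∈ P`, `w_ξ ≠ 0`
  refine ⟨ξ, hρ, μW, hfin, hinv, Φ, hwdef ξ, ?_, ?_⟩
  · rw [← hw, hwv]
    exact P.space.toSubmodule.smul_mem _ hvmem
  · rw [← hw, hwv]
    exact smul_ne_zero (inv_ne_zero hc0) hv0

end Seam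

end Summit.HodgeConjecture.HodgeConjecture.Cruxes.HLiu418.F0LD1CharSeamOfMeets

end
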